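import Mathlib
import Summits.Ventures.PercRepro2.Defs
import Summits.Ventures.PercRepro2.Independence
import Summits.Ventures.PercRepro2.Harris
import Summits.Ventures.PercRepro2.Graph
import Summits.Ventures.PercRepro2.Exploration
import Summits.Ventures.PercRepro2.Events
import Summits.Ventures.PercRepro2.Induced
import Summits.Ventures.PercRepro2.BoxUnionDefs
import Summits.Ventures.PercRepro2.BoxUnion
import Summits.Ventures.PercRepro2.BoxUnionPair
import Summits.Ventures.PercRepro2.PairTP2
import Summits.Ventures.PercRepro2.PairTP2Main
import Summits.Ventures.PercRepro2.SeparatedDefs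
import Summits.Ventures.PercRepro2.SeparatedPair
import Summits.Ventures.PercRepro2.PairTP2BroomLemmas

/-!
# (PAIR-TP2), the (⟹) direction — part 2: the double broom
(blind cell PercRepro2, mine-1 g39; proofs/MINE1-PAIRTP2.md §2′ without walks)

The DATA of a double broom inside `G`: a configuration `ω₀` with `s ↮ t`, `s ↔ u`, `t ↔ v`, whose
only open edge at `s` is `f_s` and at `t` is `f_t`; an off-terminal interface `ρ` with `u ↔ v` in
`ω₁ = ω₀ ∨ ρ`, and an edge `g` of `ρ` without which `u ↮ v`. On the configurations AGREEING with
`ω₁` off `f_s, g, f_t` the broom behaves like the path `s –f_s– u′ –g– v′ –f_t– t`: `s` is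
isolated when `f_s` is closed (`eq_s_of_conn`), `t` when `f_t` is closed, `u ↮ v` when `g` is
closed (`not_conn_uv`), `t ↔ v` when `f_t` is open (`conn_tv`), `u ↔ v` when `g` and the other
terminal edge are open (the leaf lemma, `conn_uv_of_fs_closed`), `s ↔ t` when all three are open.
The extraction of a broom from a linkable and interfaced pair is in `PairTP2BroomExists`; the four
masses and the violation of log-supermodularity in `PairTP2BroomGrid`.
-/

namespace Summit.Ventures.PercRepro2

namespace PairTP2Broom

open Finset
open scoped Classical

variable {V : Type*} {E : Type*} {ends : E → Sym2 V}

/-! ### The double broom -/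

variable [DecidableEq E]

/-- **The double-broom data**: a configuration `ω₀` with `s ↮ t`, `s ↔ u`, `t ↔ v`, whose only
open edge at `s` is `f_s` and at `t` is `f_t`; an off-terminal interface `ρ` with `u ↔ v` in
`ω₀ ∨ ρ`, and an edge `g` of `ρ` without which `u ↮ v`. -/
structure Broom (ends : E → Sym2 V) (s t u v : V) where
  /-- the linking configuration -/
  ω₀ : Config E
  /-- the interface -/
  ρ : Config E
  /-- the only open edge of `ω₀` at `s` -/
  fs : E
  /-- the only open edge of `ω₀` at `t` -/
  ft : E
  /-- the critical interface edge -/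
  g : E
  hst : ¬ Conn ends ω₀ s t
  hsu : Conn ends ω₀ s u
  htv : Conn ends ω₀ t v
  hfs : ω₀ fs = true
  hfs_mem : s ∈ ends fs
  hfs_uniq : ∀ e, ω₀ e = true → s ∈ ends e → e = fs
  hft : ω₀ ft = true
  hft_mem : t ∈ ends ft
  hft_uniq : ∀ e, ω₀ e = true → t ∈ ends e → e = ft
  hρ : ∀ e, ρ e = true → s ∉ ends e ∧ t ∉ ends e
  hg : ρ g = true
  hg_min : ¬ Conn ends (fun e => ω₀ e || Function.update ρ g false e) u v
  huv : Conn ends (fun e => ω₀ e || ρ e) u v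
  hus : u ≠ s
  hut : u ≠ t
  hvs : v ≠ s
  hvt : v ≠ t

variable {s t u v : V}

/-- The mirror image of a broom: exchange `(s, u, f_s)` with `(t, v, f_t)`. -/
def Broom.symm (B : Broom ends s t u v) : Broom ends t s v u where
  ω₀ := B.ω₀
  ρ := B.ρ
  fs := B.ft
  ft := B.fs
  g := B.g
  hst := fun h => B.hst (conn_symm h)
  hsu := B.htv
  htv := B.hsu
  hfs := B.hft
  hfs_mem := B.hft_mem
  hfs_uniq := B.hft_uniq
  hft := B.hfs
  hft_mem := B.hfs_mem
  hft_uniq := B.hfs_uniq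
  hρ := fun e he => ⟨(B.hρ e he).2, (B.hρ e he).1⟩
  hg := B.hg
  hg_min := fun h => B.hg_min (conn_symm h)
  huv := conn_symm B.huv
  hus := B.hvt
  hut := B.hvs
  hvs := B.hut
  hvt := B.hus

namespace Broom

/-- The whole broom `ω₁ = ω₀ ∨ ρ`. -/
def ω₁ (B : Broom ends s t u v) : Config E := fun e => B.ω₀ e || B.ρ e

/-- `s ≠ t`. -/
lemma s_ne_t (B : Broom ends s t u v) : s ≠ t := fun h => B.hst (h ▸ conn_refl ends B.ω₀ s)

/-- `u ≠ v`. -/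
lemma u_ne_v (B : Broom ends s t u v) : u ≠ v := by
  intro h
  subst h
  exact B.hst (conn_trans B.hsu (conn_symm B.htv))

/-- The critical edge is closed in `ω₀`. -/
lemma ω₀_g (B : Broom ends s t u v) : B.ω₀ B.g = false := by
  by_contra h
  have h' : B.ω₀ B.g = true := by simpa using h
  apply B.hg_min
  have : (fun e => B.ω₀ e || Function.update B.ρ B.g false e) = B.ω₁ := by
    funext e
    by_cases he : e = B.g
    · rw [he, Function.update_self, h']
      simp [ω₁, h']
    · rw [Function.update_of_ne he]
      rfl
  rw [this]
  exact B.huv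

/-- The critical edge avoids the terminals. -/
lemma g_off (B : Broom ends s t u v) : s ∉ ends B.g ∧ t ∉ ends B.g := B.hρ B.g B.hg

/-- `f_s ≠ g`. -/
lemma fs_ne_g (B : Broom ends s t u v) : B.fs ≠ B.g := fun h => B.g_off.1 (h ▸ B.hfs_mem)

/-- `f_t ≠ g`. -/
lemma ft_ne_g (B : Broom ends s t u v) : B.ft ≠ B.g := fun h => B.g_off.2 (h ▸ B.hft_mem)

/-- `t` is not an endpoint of `f_s`. -/
lemma t_not_mem_fs (B : Broom ends s t u v) : t ∉ ends B.fs := by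
  intro ht
  have : ends B.fs = s(s, t) := (Sym2.mem_and_mem_iff B.s_ne_t).1 ⟨B.hfs_mem, ht⟩
  exact B.hst (conn_of_openAdj ⟨B.fs, B.hfs, this⟩)

/-- `s` is not an endpoint of `f_t`. -/
lemma s_not_mem_ft (B : Broom ends s t u v) : s ∉ ends B.ft := by
  intro hs
  have : ends B.ft = s(s, t) := (Sym2.mem_and_mem_iff B.s_ne_t).1 ⟨hs, B.hft_mem⟩
  exact B.hst (conn_of_openAdj ⟨B.ft, B.hft, this⟩)

/-- `f_s ≠ f_t`. -/
lemma fs_ne_ft (B : Broom ends s t u v) : B.fs ≠ B.ft := fun h => B.s_not_mem_ft (h ▸ B.hfs_mem)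

/-- `ω₁` on the three critical edges. -/
lemma ω₁_fs (B : Broom ends s t u v) : B.ω₁ B.fs = true := by simp [ω₁, B.hfs]

/-- `ω₁` on `f_t`. -/
lemma ω₁_ft (B : Broom ends s t u v) : B.ω₁ B.ft = true := by simp [ω₁, B.hft]

/-- `ω₁` on `g`. -/
lemma ω₁_g (B : Broom ends s t u v) : B.ω₁ B.g = true := by simp [ω₁, B.hg]

/-- `ω₀ ≤ ω₁`. -/
lemma ω₀_le_ω₁ (B : Broom ends s t u v) : B.ω₀ ≤ B.ω₁ := config_le_of_imp fun e he => by simp [ω₁, he]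

/-- The only open edge of `ω₁` at `s` is `f_s`. -/
lemma ω₁_uniq_s (B : Broom ends s t u v) : ∀ e, B.ω₁ e = true → s ∈ ends e → e = B.fs := by
  intro e he hs
  simp only [ω₁, Bool.or_eq_true] at he
  rcases he with he | he
  · exact B.hfs_uniq e he hs
  · exact absurd hs (B.hρ e he).1

/-- The only open edge of `ω₁` at `t` is `f_t`. -/
lemma ω₁_uniq_t (B : Broom ends s t u v) : ∀ e, B.ω₁ e = true → t ∈ ends e → e = B.ft := by
  intro e he ht
  simp only [ω₁, Bool.or_eq_true] at he
  rcases he with he | he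
  · exact B.hft_uniq e he ht
  · exact absurd ht (B.hρ e he).2

/-- `ω₁` with `g` closed is `ω₀ ∨ (ρ − g)`, so `u ↮ v` there. -/
lemma not_conn_ω₁_g (B : Broom ends s t u v) : ¬ Conn ends (Function.update B.ω₁ B.g false) u v := by
  have : Function.update B.ω₁ B.g false = fun e => B.ω₀ e || Function.update B.ρ B.g false e := by
    funext e
    by_cases he : e = B.g
    · rw [he, Function.update_self, Function.update_self, B.ω₀_g]
      rfl
    · rw [Function.update_of_ne he, Function.update_of_ne he]
      rfl
  rw [this]
  exact B.hg_min

/-- `t ↔ v` survives closing `f_s`. -/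
lemma conn_tv_update_fs (B : Broom ends s t u v) : Conn ends (Function.update B.ω₀ B.fs false) t v := by
  have h := cluster_update_false_of_not_touches (ends := ends) (ω := B.ω₀) (v := t)
    (not_touches_cluster_of_open_at (fun h => B.hst (conn_symm h)) B.hfs B.hfs_mem)
  have hv : v ∈ cluster ends B.ω₀ t := B.htv
  rw [← h] at hv
  exact hv

/-- `s ↔ u` survives closing `f_t`. -/
lemma conn_su_update_ft (B : Broom ends s t u v) : Conn ends (Function.update B.ω₀ B.ft false) s u :=
  B.symm.conn_tv_update_fs


/-! ### Configurations agreeing with the broom off the three critical edges -/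

/-- `ω` agrees with `ω₁` off `f_s, g, f_t`. -/
def Agrees (B : Broom ends s t u v) (ω : Config E) : Prop :=
  ∀ e, e ≠ B.fs → e ≠ B.g → e ≠ B.ft → ω e = B.ω₁ e

/-- Agreement is symmetric under the mirror. -/
lemma Agrees.symm {B : Broom ends s t u v} {ω : Config E} (hA : B.Agrees ω) : B.symm.Agrees ω :=
  fun e h1 h2 h3 => hA e h3 h2 h1

/-- `ω₁` agrees with itself. -/
lemma agrees_ω₁ (B : Broom ends s t u v) : B.Agrees B.ω₁ := fun _ _ _ _ => rfl

/-- With `f_s` closed, `s` has no open edge. -/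
lemma isolated_s (B : Broom ends s t u v) {ω : Config E} (hA : B.Agrees ω) (h0 : ω B.fs = false) :
    ∀ e, ω e = true → s ∉ ends e := by
  intro e he hs
  by_cases h1 : e = B.fs
  · rw [h1, h0] at he
    exact Bool.false_ne_true he
  by_cases h2 : e = B.g
  · exact B.g_off.1 (h2 ▸ hs)
  by_cases h3 : e = B.ft
  · exact B.s_not_mem_ft (h3 ▸ hs)
  rw [hA e h1 h2 h3] at he
  exact h1 (B.ω₁_uniq_s e he hs)

/-- With `f_s` closed, `s` is connected to nothing else. -/
lemma eq_s_of_conn (B : Broom ends s t u v) {ω : Config E} (hA : B.Agrees ω) (h0 : ω B.fs = false)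
    {x : V} (h : Conn ends ω s x) : x = s :=
  eq_of_conn_of_isolated (B.isolated_s hA h0) h

/-- With `f_t` closed, `t` is connected to nothing else. -/
lemma eq_t_of_conn (B : Broom ends s t u v) {ω : Config E} (hA : B.Agrees ω) (h0 : ω B.ft = false)
    {x : V} (h : Conn ends ω t x) : x = t :=
  B.symm.eq_s_of_conn hA.symm h0 h

/-- With `g` closed, `ω ≤ ω₁ − g`. -/
lemma le_ω₁_update_g (B : Broom ends s t u v) {ω : Config E} (hA : B.Agrees ω)
    (h2 : ω B.g = false) : ω ≤ Function.update B.ω₁ B.g false := by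
  refine config_le_of_imp fun e he => ?_
  by_cases hg : e = B.g
  · rw [hg, h2] at he
    exact absurd he Bool.false_ne_true
  rw [Function.update_of_ne hg]
  by_cases h1 : e = B.fs
  · rw [h1]; exact B.ω₁_fs
  by_cases h3 : e = B.ft
  · rw [h3]; exact B.ω₁_ft
  rw [← hA e h1 hg h3]
  exact he

/-- With `g` closed, `u ↮ v`. -/
lemma not_conn_uv (B : Broom ends s t u v) {ω : Config E} (hA : B.Agrees ω) (h2 : ω B.g = false) :
    ¬ Conn ends ω u v :=
  fun h => B.not_conn_ω₁_g (conn_mono (B.le_ω₁_update_g hA h2) h)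

/-- With `f_t` open, `ω₀ − f_s ≤ ω`. -/
lemma update_fs_le (B : Broom ends s t u v) {ω : Config E} (hA : B.Agrees ω) (h3 : ω B.ft = true) :
    Function.update B.ω₀ B.fs false ≤ ω := by
  refine config_le_of_imp fun e he => ?_
  by_cases h1 : e = B.fs
  · rw [h1, Function.update_self] at he
    exact absurd he Bool.false_ne_true
  rw [Function.update_of_ne h1] at he
  by_cases hg : e = B.g
  · rw [hg, B.ω₀_g] at he
    exact absurd he Bool.false_ne_true
  by_cases h3' : e = B.ft
  · rw [h3']; exact h3
  rw [hA e h1 hg h3']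
  simp [ω₁, he]

/-- With `f_t` open, `t ↔ v`. -/
lemma conn_tv (B : Broom ends s t u v) {ω : Config E} (hA : B.Agrees ω) (h3 : ω B.ft = true) :
    Conn ends ω t v :=
  conn_mono (B.update_fs_le hA h3) B.conn_tv_update_fs

/-- With `f_s` open, `s ↔ u`. -/
lemma conn_su (B : Broom ends s t u v) {ω : Config E} (hA : B.Agrees ω) (h1 : ω B.fs = true) :
    Conn ends ω s u :=
  B.symm.conn_tv hA.symm h1

/-- The configuration `(0, 1, 1)` is `ω₁ − f_s`. -/
lemma eq_update_ω₁_fs (B : Broom ends s t u v) {ω : Config E} (hA : B.Agrees ω) (h0 : ω B.fs = false)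
    (h2 : ω B.g = true) (h3 : ω B.ft = true) : ω = Function.update B.ω₁ B.fs false := by
  funext e
  by_cases h1 : e = B.fs
  · rw [h1, Function.update_self, h0]
  rw [Function.update_of_ne h1]
  by_cases hg : e = B.g
  · rw [hg, h2, B.ω₁_g]
  by_cases h3' : e = B.ft
  · rw [h3', h3, B.ω₁_ft]
  exact hA e h1 hg h3'

/-- In `(0, 1, 1)`, `u ↔ v` (the leaf lemma at `s`). -/
lemma conn_uv_of_fs_closed (B : Broom ends s t u v) {ω : Config E} (hA : B.Agrees ω)
    (h0 : ω B.fs = false) (h2 : ω B.g = true) (h3 : ω B.ft = true) : Conn ends ω u v := by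
  rw [B.eq_update_ω₁_fs hA h0 h2 h3]
  exact conn_update_false_of_leaf (Sym2.other_spec B.hfs_mem).symm B.ω₁_uniq_s B.hus B.hvs B.huv

/-- In `(1, 1, 0)`, `u ↔ v` (the leaf lemma at `t`). -/
lemma conn_uv_of_ft_closed (B : Broom ends s t u v) {ω : Config E} (hA : B.Agrees ω)
    (h1 : ω B.fs = true) (h2 : ω B.g = true) (h0 : ω B.ft = false) : Conn ends ω u v :=
  conn_symm (B.symm.conn_uv_of_fs_closed hA.symm h0 h2 h1)

/-- In `(1, 1, 1)`, `s ↔ t`. -/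
lemma conn_st_of_all_open (B : Broom ends s t u v) {ω : Config E} (hA : B.Agrees ω)
    (h1 : ω B.fs = true) (h2 : ω B.g = true) (h3 : ω B.ft = true) : Conn ends ω s t := by
  have hω : ω = B.ω₁ := by
    funext e
    by_cases hfs : e = B.fs
    · rw [hfs, h1, B.ω₁_fs]
    by_cases hg : e = B.g
    · rw [hg, h2, B.ω₁_g]
    by_cases hft : e = B.ft
    · rw [hft, h3, B.ω₁_ft]
    exact hA e hfs hg hft
  rw [hω]
  exact conn_trans (conn_mono B.ω₀_le_ω₁ B.hsu)
    (conn_trans B.huv (conn_symm (conn_mono B.ω₀_le_ω₁ B.htv)))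

end Broom

end PairTP2Broom

end Summit.Ventures.PercRepro2
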